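import Summits.QuantumFields.QCD.Theses.PauliWegnerSea
import Summits.QuantumFields.QCD.Theorems.PauliWegnerSeaPhaseQuenchedFlavourDecayPionSecondMomentOfCrux
import Literature.MathematicalPhysics.QuantumFieldTheory.QCDPhaseQuenchedReweighting
import Literature.MathematicalPhysics.QuantumFieldTheory.QCDPhaseQuenchedPositivity
import Literature.MathematicalPhysics.QuantumFieldTheory.FermiFlavourPhase
import Literature.MathematicalPhysics.QuantumFieldTheory.QCDCurrentSector
import Literature.MathematicalPhysics.QuantumFieldTheory.QCDGoldstoneBound
import Literature.MathematicalPhysics.QuantumFieldTheory.QCDWickMinorMeasurability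
import Literature.MathematicalPhysics.QuantumFieldTheory.QCDHeavyQuarkPropagator

/-!
# Stub `stub_chiralityTransfer` of line `Sketch` (crux `PauliWegnerSea.ChiralOneScaleTrajectory`, stmt-QuantumFields-17512)

**Chirality transfer: a signed second-moment pin forces chiral gaplessness.**

Fix `N_f` flavours and two distinct flavours `f ≠ g` (so `N_f ≥ 2`).  Assume

* `hW` — the un-normalised Wick–`γ₅` identity for the charged pion pair at fully degenerate bare
  masses `m_· ≡ t`: in every `SU(3)` background `U` on every torus,
  `∫dψ̄dψ (ψ̄_g γ₅ ψ_f)(x) (ψ̄_f γ₅ ψ_g)(y) e^{-ψ̄D(U)ψ} = ε · ( −det D_t(U)^{N_f−2} Σ_{a,i,b,j} |adj D_t(U)((x,a,i),(y,b,j))|² )`,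
  `D_t = D_W(U, t, r = 1)` the one-flavour Wilson matrix, `ε = (−1)^{n(n−1)/2+n}` the Berezin
  orientation sign (proved by a sibling stub; consumed here as a hypothesis);
* `hpin` — the *signed second-moment pin* of the regularisation `reg`: for every `ε > 0` there is a
  renormalised mass `m > 0` such that for every constant `C`, frequently in `k`, on some admissible
  torus `2S+1 ≥ 2L_k+1` and some time separation `n ≤ S`, the signed quotient
  `Q = ∫ det D · Σ|D⁻¹_f(0 → n e₀)|² dμ_W / ∫ det D dμ_W` at the degenerate bare masses
  `m_crit(k) + a_k m / Z_m(k)` has `‖Q‖ > C e^{−ε a_k n}`.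

Then `reg.IsChiralAtZero`: for every `ε > 0` the degenerate positive tuple `m_f ≡ m` is a point at
which the scheme `reg.scheme m 0 0` has NO uniform lattice mass gap `ε`.

Proof (folklore bookkeeping).  If the gap held, apply it to the flavour-charged pseudoscalar pair
`A = ψ̄_g γ₅ ψ_f`, `B = ψ̄_f γ₅ ψ_g`; flavour charge kills the disconnected part
(`IsFlavourCharged.qcdLatticeConnectedCorr_eq`), and by `hW` and `∫dψ̄dψ e^{-ψ̄Dψ} = ε det D` the
connected correlator is `corr = −∫ψ dμ_W / ∫ det D dμ_W` with
`ψ = det D_t^{N_f−2} Σ|adj D_t|²`, while `Q = ∫φ dμ_W / ∫ det D dμ_W` with `φ = det D · Σ|D⁻¹|²` — the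
SAME denominator.  Pointwise in `U` (no null-set input): `det D = det D_t^{N_f}` is real; where
`det D_t ≠ 0`, `D⁻¹ = det D_t⁻¹ adj D_t` on the flavour block gives `φ = ψ`; where `det D_t = 0`,
`φ = 0` and `ψ = 0^{N_f−2} Σ|adj|² ≥ 0` (`= 0` for `N_f ≥ 3`).  Hence `φ = ψ` (`N_f ≥ 3`) or
`0 ≤ φ ≤ ψ` (`N_f = 2`), so `‖∫φ‖ ≤ ‖∫ψ‖` (`ψ` continuous on the compact configuration space, hence
integrable) and `‖Q‖ ≤ ‖corr‖ ≤ C e^{−ε a_k n}`, contradicting the pin at the common `k, S, n`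
supplied by `Frequently.and_eventually`.

Sources: I. Montvay, G. Münster, *Quantum Fields on a Lattice* (CUP 1994), §5.1 (Wilson quark
determinant, flavour symmetry, critical hopping parameter); K. Osterwalder, E. Seiler, *Gauge field
theories on a lattice*, Ann. Phys. 110 (1978) 440, §2 (lattice QCD functional).  Folklore bookkeeping
over the tree's objects.
-/

noncomputable section

namespace Summit.QuantumFields.QCD.Cruxes.ChiralOneScaleTrajectory.GoldstoneWitness

open scoped BigOperators
open MeasureTheory Filter
open Literature.MathematicalPhysics.QuantumFieldTheory Literature.MathematicalPhysics.QuantumLattice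
  Literature.Probability.LatticeModels
open Summit.QuantumFields.QCD.Cruxes.PhaseQuenchedFlavourDecay.CrossingSplitIntegrability

/-! ### Elementary real-analysis bookkeeping -/

/-- If two real functions satisfy `φ = ψ` everywhere, or `0 ≤ φ ≤ ψ` everywhere with `ψ` integrable and
`φ` measurable, then `|∫φ| ≤ |∫ψ|`. [folklore] -/
theorem abs_integral_le_abs_integral_of_eq_or_nonneg_le {Ω : Type*} [MeasurableSpace Ω]
    {μ : Measure Ω} {φ ψ : Ω → ℝ} (hψ : Integrable ψ μ) (hφ : AEStronglyMeasurable φ μ)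
    (h : (∀ x, φ x = ψ x) ∨ ∀ x, 0 ≤ φ x ∧ φ x ≤ ψ x) :
    |∫ x, φ x ∂μ| ≤ |∫ x, ψ x ∂μ| := by
  rcases h with h | h
  · rw [show φ = ψ from funext h]
  · have hφi : Integrable φ μ :=
      hψ.mono hφ (Eventually.of_forall fun x => by
        rw [Real.norm_eq_abs, Real.norm_eq_abs, abs_of_nonneg (h x).1]
        exact (h x).2.trans (le_abs_self _))
    have h0 : 0 ≤ ∫ x, φ x ∂μ := integral_nonneg fun x => (h x).1
    have h1 : ∫ x, φ x ∂μ ≤ ∫ x, ψ x ∂μ := integral_mono hφi hψ fun x => (h x).2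
    rw [abs_of_nonneg h0, abs_of_nonneg (h0.trans h1)]
    exact h1

variable {Nf L : ℕ} [NeZero L]

/-- A continuous real function of the `SU(3)` gauge field on a finite torus (a compact space) is
integrable against every finite measure, in particular against the Wilson measure. [folklore] -/
theorem integrable_of_continuous_gaugeConfig {F : GaugeConfig 4 L SU3 → ℝ} (hF : Continuous F)
    (μ : Measure (GaugeConfig 4 L SU3)) [IsFiniteMeasure μ] : Integrable F μ := by
  obtain ⟨U₀, -, hU₀⟩ := (isCompact_univ (X := GaugeConfig 4 L SU3)).exists_isMaxOn
    Set.univ_nonempty hF.norm.continuousOn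
  exact Integrable.of_bound hF.aestronglyMeasurable ‖F U₀‖
    (Eventually.of_forall fun U => hU₀ (Set.mem_univ U))

/-! ### Pointwise facts about the degenerate-mass Wilson–Dirac matrix -/

/-- **The one-flavour Wilson determinant is real** (γ₅-hermiticity, Montvay–Münster (5.16)):
`det D_t(U)` equals the cast of its real part. -/
theorem det_wilsonDirac_eq_ofReal_re (U : GaugeConfig 4 L SU3) (t : ℝ) :
    (wilsonDirac (fundamentalRep (Fin 3)) U t 1).det =
      (((wilsonDirac (fundamentalRep (Fin 3)) U t 1).det.re : ℝ) : ℂ) :=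
  Complex.ext (by simp) (by
    simpa using fermionDet_wilsonDirac_im_holds (L := L) (fundamentalRep (Fin 3))
      (fun g => fundamentalRep_mem_unitaryGroup g) U t 1)

/-- **`det D = det D_t ^ N_f` at fully degenerate bare masses** `m_f ≡ t` (block-diagonal flavour
structure, Montvay–Münster §5.1). -/
theorem det_diracMatrix_const (U : GaugeConfig 4 L SU3) (t : ℝ) :
    (diracMatrix U fun _ : Fin Nf => t).det = (wilsonDirac (fundamentalRep (Fin 3)) U t 1).det ^ Nf := by
  simp only [det_diracMatrix, fermionDet, Finset.prod_const, Finset.card_univ, Fintype.card_fin]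

/-- Real parts: `Re det D = (Re det D_t) ^ N_f` at degenerate masses. [folklore] -/
theorem det_diracMatrix_const_re (U : GaugeConfig 4 L SU3) (t : ℝ) :
    ((diracMatrix U fun _ : Fin Nf => t).det).re =
      ((wilsonDirac (fundamentalRep (Fin 3)) U t 1).det.re) ^ Nf := by
  rw [det_diracMatrix_const, det_wilsonDirac_eq_ofReal_re, ← Complex.ofReal_pow, Complex.ofReal_re,
    Complex.ofReal_re]

/-- **Propagator entries via the adjugate** on an invertible background: for `det D_t(U) ≠ 0`,
`|D⁻¹((f,X),(f,Y))|² = (Re det D_t)⁻² |adj D_t(X,Y)|²` (`D⁻¹` is flavour-diagonal with block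
`D_t⁻¹ = det D_t⁻¹ adj D_t`, and `det D_t` is real). -/
theorem norm_inv_diracMatrix_const_sq (U : GaugeConfig 4 L SU3) (t : ℝ)
    (h : (wilsonDirac (fundamentalRep (Fin 3)) U t 1).det ≠ 0) (f : Fin Nf)
    (X Y : TorusSite 4 L × Fin 3 × Fin 4) :
    ‖(diracMatrix U fun _ : Fin Nf => t)⁻¹ (quarkEquiv (f, X)) (quarkEquiv (f, Y))‖ ^ 2 =
      (((wilsonDirac (fundamentalRep (Fin 3)) U t 1).det.re) ^ 2)⁻¹ *
        ‖(wilsonDirac (fundamentalRep (Fin 3)) U t 1).adjugate X Y‖ ^ 2 := by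
  rw [inv_diracMatrix_apply_same_flavour U (fun _ : Fin Nf => t) (fun _ => h) f X Y, Matrix.inv_def,
    Matrix.smul_apply, smul_eq_mul, Ring.inverse_eq_inv, norm_mul, norm_inv, mul_pow, inv_pow,
    det_wilsonDirac_eq_ofReal_re, Complex.norm_real, Real.norm_eq_abs, sq_abs, Complex.ofReal_re]

/-- **Invertible backgrounds: `φ = ψ`.**  For `det D_t(U) ≠ 0` and `N_f ≥ 2`,
`Re det D · Σ|D⁻¹_f(x → y)|² = (Re det D_t)^{N_f−2} · Σ|adj D_t(x → y)|²`. [folklore] -/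
theorem phiR_eq_psiR_of_det_ne_zero (hNf : 2 ≤ Nf) (U : GaugeConfig 4 L SU3) (t : ℝ)
    (h : (wilsonDirac (fundamentalRep (Fin 3)) U t 1).det ≠ 0) (f : Fin Nf) (x y : TorusSite 4 L) :
    ((diracMatrix U fun _ : Fin Nf => t).det).re *
        ∑ a : Fin 3, ∑ i : Fin 4, ∑ b : Fin 3, ∑ j : Fin 4,
          ‖(diracMatrix U fun _ : Fin Nf => t)⁻¹ (quarkEquiv (f, (x, a, i)))
            (quarkEquiv (f, (y, b, j)))‖ ^ 2 =
      ((wilsonDirac (fundamentalRep (Fin 3)) U t 1).det.re) ^ (Nf - 2) *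
        ∑ a : Fin 3, ∑ i : Fin 4, ∑ b : Fin 3, ∑ j : Fin 4,
          ‖(wilsonDirac (fundamentalRep (Fin 3)) U t 1).adjugate (x, a, i) (y, b, j)‖ ^ 2 := by
  have hd0 : (wilsonDirac (fundamentalRep (Fin 3)) U t 1).det.re ≠ 0 := fun h0 =>
    h (by rw [det_wilsonDirac_eq_ofReal_re, h0, Complex.ofReal_zero])
  simp only [det_diracMatrix_const_re, norm_inv_diracMatrix_const_sq U t h, ← Finset.mul_sum]
  rw [← mul_assoc, ← pow_sub₀ _ hd0 hNf]

/-- **Singular backgrounds: `φ = 0`.**  For `det D_t(U) = 0` (and `N_f ≠ 0`), `det D = 0`, so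
`Re det D · Σ|D⁻¹|² = 0`. [folklore] -/
theorem phiR_eq_zero_of_det_eq_zero (hNf : Nf ≠ 0) (U : GaugeConfig 4 L SU3) (t : ℝ)
    (h : (wilsonDirac (fundamentalRep (Fin 3)) U t 1).det = 0) (f : Fin Nf) (x y : TorusSite 4 L) :
    ((diracMatrix U fun _ : Fin Nf => t).det).re *
        ∑ a : Fin 3, ∑ i : Fin 4, ∑ b : Fin 3, ∑ j : Fin 4,
          ‖(diracMatrix U fun _ : Fin Nf => t)⁻¹ (quarkEquiv (f, (x, a, i)))
            (quarkEquiv (f, (y, b, j)))‖ ^ 2 = 0 := by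
  rw [det_diracMatrix_const_re, h, Complex.zero_re, zero_pow hNf, zero_mul]

/-- `ψ(U) = (Re det D_t)^{p} Σ|adj D_t(x → y)|²` is a continuous function of the gauge field
(polynomial in the link entries). [folklore] -/
theorem continuous_psiR (t : ℝ) (x y : TorusSite 4 L) (p : ℕ) :
    Continuous fun U : GaugeConfig 4 L SU3 =>
      ((wilsonDirac (fundamentalRep (Fin 3)) U t 1).det.re) ^ p *
        ∑ a : Fin 3, ∑ i : Fin 4, ∑ b : Fin 3, ∑ j : Fin 4,
          ‖(wilsonDirac (fundamentalRep (Fin 3)) U t 1).adjugate (x, a, i) (y, b, j)‖ ^ 2 := by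
  have hc : Continuous fun U : GaugeConfig 4 L SU3 => wilsonDirac (fundamentalRep (Fin 3)) U t 1 :=
    continuous_wilsonDirac _ (continuous_fundamentalRep (Fin 3)) t 1
  refine ((Complex.continuous_re.comp hc.matrix_det).pow p).mul ?_
  refine continuous_finsetSum _ fun a _ => continuous_finsetSum _ fun i _ =>
    continuous_finsetSum _ fun b _ => continuous_finsetSum _ fun j _ => ?_
  exact ((hc.matrix_adjugate.matrix_elem (x, a, i) (y, b, j)).norm).pow 2

/-- `φ(U) = Re det D · Σ|D⁻¹(P_{a i}, Q_{b j})|²` is a measurable function of the gauge field. [folklore] -/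
theorem measurable_phiR (mq : Fin Nf → ℝ) (P Q : Fin 3 → Fin 4 → FermiIdx Nf L) :
    Measurable fun U : GaugeConfig 4 L SU3 =>
      ((diracMatrix U mq).det).re * ∑ a : Fin 3, ∑ i : Fin 4, ∑ b : Fin 3, ∑ j : Fin 4,
        ‖(diracMatrix U mq)⁻¹ (P a i) (Q b j)‖ ^ 2 := by
  refine (Complex.measurable_re.comp (continuous_det_diracMatrix mq).measurable).mul ?_
  refine Finset.measurable_sum _ fun a _ => Finset.measurable_sum _ fun i _ =>
    Finset.measurable_sum _ fun b _ => Finset.measurable_sum _ fun j _ => ?_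
  exact ((measurable_inv_diracMatrix_apply mq (P a i) (Q b j)).norm).pow_const 2

/-! ### The key inequality `‖Q‖ ≤ ‖corr‖` -/

/-- **Numerators compare: `‖∫ det D · Σ|D⁻¹_f|² dμ‖ ≤ ‖∫ det D_t^{N_f−2} Σ|adj D_t|² dμ‖`** at
degenerate bare masses, for every finite measure on configurations.  Pointwise the two integrands are
real and agree where `det D_t ≠ 0`; where `det D_t = 0` the first vanishes and the second is
`0^{N_f−2} Σ|adj|² ≥ 0`, so they agree for `N_f ≥ 3` and satisfy `0 ≤ φ ≤ ψ` for `N_f = 2`. [folklore] -/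
theorem norm_integral_phi_le_norm_integral_psi (hNf : 2 ≤ Nf) (f : Fin Nf) (t : ℝ)
    (x y : TorusSite 4 L) (μ : Measure (GaugeConfig 4 L SU3)) [IsFiniteMeasure μ] :
    ‖∫ U, (diracMatrix U fun _ : Fin Nf => t).det *
        ((∑ a : Fin 3, ∑ i : Fin 4, ∑ b : Fin 3, ∑ j : Fin 4,
          ‖(diracMatrix U fun _ : Fin Nf => t)⁻¹ (quarkEquiv (f, (x, a, i)))
            (quarkEquiv (f, (y, b, j)))‖ ^ (2 : ℕ) : ℝ) : ℂ) ∂μ‖ ≤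
    ‖∫ U, (wilsonDirac (fundamentalRep (Fin 3)) U t 1).det ^ (Nf - 2) *
        ((∑ a : Fin 3, ∑ i : Fin 4, ∑ b : Fin 3, ∑ j : Fin 4,
          ‖(wilsonDirac (fundamentalRep (Fin 3)) U t 1).adjugate (x, a, i) (y, b, j)‖ ^ (2 : ℕ) :
            ℝ) : ℂ) ∂μ‖ := by
  set φr : GaugeConfig 4 L SU3 → ℝ := fun U => ((diracMatrix U fun _ : Fin Nf => t).det).re *
      ∑ a : Fin 3, ∑ i : Fin 4, ∑ b : Fin 3, ∑ j : Fin 4,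
        ‖(diracMatrix U fun _ : Fin Nf => t)⁻¹ (quarkEquiv (f, (x, a, i)))
          (quarkEquiv (f, (y, b, j)))‖ ^ 2 with hφr
  set ψr : GaugeConfig 4 L SU3 → ℝ := fun U =>
      ((wilsonDirac (fundamentalRep (Fin 3)) U t 1).det.re) ^ (Nf - 2) *
        ∑ a : Fin 3, ∑ i : Fin 4, ∑ b : Fin 3, ∑ j : Fin 4,
          ‖(wilsonDirac (fundamentalRep (Fin 3)) U t 1).adjugate (x, a, i) (y, b, j)‖ ^ 2 with hψr
  have hφ : ∀ U, (diracMatrix U fun _ : Fin Nf => t).det *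
      ((∑ a : Fin 3, ∑ i : Fin 4, ∑ b : Fin 3, ∑ j : Fin 4,
        ‖(diracMatrix U fun _ : Fin Nf => t)⁻¹ (quarkEquiv (f, (x, a, i)))
          (quarkEquiv (f, (y, b, j)))‖ ^ (2 : ℕ) : ℝ) : ℂ) = ((φr U : ℝ) : ℂ) := fun U => by
    simp only [hφr, Complex.ofReal_mul, ← det_diracMatrix_eq_ofReal_re]
  have hψ : ∀ U, (wilsonDirac (fundamentalRep (Fin 3)) U t 1).det ^ (Nf - 2) *
      ((∑ a : Fin 3, ∑ i : Fin 4, ∑ b : Fin 3, ∑ j : Fin 4,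
        ‖(wilsonDirac (fundamentalRep (Fin 3)) U t 1).adjugate (x, a, i) (y, b, j)‖ ^ (2 : ℕ) :
          ℝ) : ℂ) = ((ψr U : ℝ) : ℂ) := fun U => by
    simp only [hψr, Complex.ofReal_mul, Complex.ofReal_pow, ← det_wilsonDirac_eq_ofReal_re]
  simp only [hφ, hψ]
  rw [integral_complex_ofReal, integral_complex_ofReal, Complex.norm_real, Complex.norm_real,
    Real.norm_eq_abs, Real.norm_eq_abs]
  refine abs_integral_le_abs_integral_of_eq_or_nonneg_le
    (integrable_of_continuous_gaugeConfig (continuous_psiR t x y (Nf - 2)) μ)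
    (measurable_phiR (fun _ : Fin Nf => t) (fun a i => quarkEquiv (f, (x, a, i)))
      (fun b j => quarkEquiv (f, (y, b, j)))).aestronglyMeasurable ?_
  rcases hNf.eq_or_lt with h2 | h2
  · -- `N_f = 2`: `0 ≤ φ ≤ ψ` pointwise
    refine Or.inr fun U => ?_
    have hψ0 : 0 ≤ ψr U := by
      simp only [hψr, (by omega : Nf - 2 = 0), pow_zero, one_mul]
      positivity
    by_cases hd : (wilsonDirac (fundamentalRep (Fin 3)) U t 1).det = 0
    · have h0 : φr U = 0 := phiR_eq_zero_of_det_eq_zero (by omega) U t hd f x y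
      rw [h0]
      exact ⟨le_rfl, hψ0⟩
    · have he : φr U = ψr U := phiR_eq_psiR_of_det_ne_zero hNf U t hd f x y
      rw [he]
      exact ⟨hψ0, le_rfl⟩
  · -- `N_f ≥ 3`: `φ = ψ` pointwise
    refine Or.inl fun U => ?_
    by_cases hd : (wilsonDirac (fundamentalRep (Fin 3)) U t 1).det = 0
    · have h0 : φr U = 0 := phiR_eq_zero_of_det_eq_zero (by omega) U t hd f x y
      rw [h0]
      simp only [hψr, hd, Complex.zero_re, zero_pow (Nat.sub_ne_zero_of_lt h2), zero_mul]
    · exact phiR_eq_psiR_of_det_ne_zero hNf U t hd f x y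

/-- **The key inequality `‖Q‖ ≤ ‖corr‖`.**  Under the un-normalised Wick–γ₅ identity `hW` for the
charged pion pair, for `f ≠ g`, every coupling `β`, degenerate bare mass `t`, torus side `L` and time
separation `n`: the norm of the signed second-moment quotient
`∫ det D Σ|D⁻¹_f(0 → n e₀)|² dμ_W / ∫ det D dμ_W` is at most the norm of the connected correlator of
`ψ̄_g γ₅ ψ_f` at `0` and `ψ̄_f γ₅ ψ_g` at `n e₀` (flavour charge removes the disconnected part; the
Berezin orientation sign and the common denominator cancel; numerators compare by
`norm_integral_phi_le_norm_integral_psi`). [folklore; Montvay–Münster §5.1, Osterwalder–Seiler §2] -/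
theorem norm_signedQuotient_le_norm_corr {f g : Fin Nf} (hfg : f ≠ g)
    (hW : ∀ (L : ℕ) [NeZero L] (U : GaugeConfig 4 L (Matrix.specialUnitaryGroup (Fin 3) ℂ)) (t : ℝ)
      (x y : TorusSite 4 L), fermiIntegral (torusBilinear g f x x gammaFive 1 *
        torusBilinear f g y y gammaFive 1 * fermiBoltzmann U (fun _ : Fin Nf => t)) =
        (-1 : ℂ) ^ (Fintype.card (FermiIdx Nf L) * (Fintype.card (FermiIdx Nf L) - 1) / 2 +
          Fintype.card (FermiIdx Nf L)) *
          -((wilsonDirac (fundamentalRep (Fin 3)) U t 1).det ^ (Nf - 2) *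
            ((∑ a : Fin 3, ∑ i : Fin 4, ∑ b : Fin 3, ∑ j : Fin 4,
              ‖(wilsonDirac (fundamentalRep (Fin 3)) U t 1).adjugate (x, a, i) (y, b, j)‖ ^ (2 : ℕ) :
                ℝ) : ℂ)))
    (β t : ℝ) (L : ℕ) [NeZero L] (n : ℕ) :
    ‖(∫ U : GaugeConfig 4 L (Matrix.specialUnitaryGroup (Fin 3) ℂ),
        (diracMatrix U fun _ : Fin Nf => t).det *
          ((∑ a : Fin 3, ∑ i : Fin 4, ∑ b : Fin 3, ∑ j : Fin 4,
            ‖(diracMatrix U fun _ : Fin Nf => t)⁻¹ (quarkEquiv (f, (Torus.proj L 0, a, i)))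
              (quarkEquiv (f, (Torus.proj L (Pi.single 0 (n : ℤ)), b, j)))‖ ^ (2 : ℕ) : ℝ) : ℂ)
        ∂(wilsonMeasure (fundamentalRep (Fin 3)) β)) /
      (∫ U : GaugeConfig 4 L (Matrix.specialUnitaryGroup (Fin 3) ℂ),
        (diracMatrix U fun _ : Fin Nf => t).det ∂(wilsonMeasure (fundamentalRep (Fin 3)) β))‖ ≤
    ‖qcdLatticeConnectedCorr β L (fun _ : Fin Nf => t)
        (pseudoscalarDensityObs Nf (Matrix.single g f (1 : ℂ)))
        (pseudoscalarDensityObs Nf (Matrix.single f g (1 : ℂ))) n‖ := by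
  have hNf : 2 ≤ Nf := Fin.nontrivial_iff_two_le.mp ⟨⟨f, g, hfg⟩⟩
  rw [(isFlavourCharged_pseudoscalarDensityObs_single hfg).qcdLatticeConnectedCorr_eq one_ne_zero]
  simp only [qcdTorusExpect, pseudoscalarDensityObs_single_onTorus, hW, fermiIntegral_fermiBoltzmann]
  rw [integral_const_mul, integral_const_mul, mul_div_mul_left _ _ (fermiOrientationSign_ne_zero _),
    integral_neg, neg_div, norm_neg, norm_div, norm_div]
  exact div_le_div_of_nonneg_right
    (norm_integral_phi_le_norm_integral_psi hNf f t _ _ _) (norm_nonneg _)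

/-- **Chirality transfer** (stub `stub_chiralityTransfer` of line `Sketch`): given the un-normalised
Wick–γ₅ identity `hW` for the charged pion pair `(ψ̄_g γ₅ ψ_f, ψ̄_f γ₅ ψ_g)`, `f ≠ g`, at fully
degenerate bare masses, a regularisation whose signed pion second moment is *pinned* — for every
`ε > 0` some renormalised mass `m > 0` at which, for every `C`, frequently in `k` the signed quotient
`‖∫ det D Σ|D⁻¹_f(0 → n e₀)|² dμ_W / ∫ det D dμ_W‖` exceeds `C e^{−ε a_k n}` on an admissible torus —
is chiral at zero: at the degenerate tuple `m_f ≡ m` the uniform lattice mass gap `ε` fails, since it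
would bound the flavour-charged pseudoscalar correlator, whose norm dominates the signed quotient
(`norm_signedQuotient_le_norm_corr`). [folklore; Montvay–Münster 1994 §5.1, Osterwalder–Seiler 1978 §2] -/
theorem stub_chiralityTransfer :
    ∀ (Nf : ℕ) (f g : Fin Nf), f ≠ g →
      (∀ (L : ℕ) [NeZero L] (U : GaugeConfig 4 L (Matrix.specialUnitaryGroup (Fin 3) ℂ)) (t : ℝ)
          (x y : TorusSite 4 L), fermiIntegral (torusBilinear g f x x gammaFive 1 * torusBilinear f g y y gammaFive 1 * fermiBoltzmann U (fun _ : Fin Nf => t)) = (-1 : ℂ) ^ (Fintype.card (FermiIdx Nf L) * (Fintype.card (FermiIdx Nf L) - 1) / 2 + Fintype.card (FermiIdx Nf L)) * -((wilsonDirac (fundamentalRep (Fin 3)) U t 1).det ^ (Nf - 2) * ((∑ a : Fin 3, ∑ i : Fin 4, ∑ b : Fin 3, ∑ j : Fin 4, ‖(wilsonDirac (fundamentalRep (Fin 3)) U t 1).adjugate (x, a, i) (y, b, j)‖ ^ (2 : ℕ) : ℝ) : ℂ))) →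
      ∀ reg : QCDRegularisation Nf, (∀ ε : ℝ, 0 < ε → ∃ m : ℝ, 0 < m ∧ ∀ C : ℝ, ∃ᶠ k in atTop, ∃ S : ℕ, reg.L k ≤ S ∧ ∃ n : ℕ, n ≤ S ∧ C * Real.exp (-(ε * (reg.a k * n))) < ‖(∫ U : GaugeConfig 4 (2 * S + 1) (Matrix.specialUnitaryGroup (Fin 3) ℂ), (diracMatrix U fun _ : Fin Nf => reg.mcrit k + reg.a k * m / reg.Zm k).det * ((∑ a : Fin 3, ∑ i : Fin 4, ∑ b : Fin 3, ∑ j : Fin 4, ‖(diracMatrix U fun _ : Fin Nf => reg.mcrit k + reg.a k * m / reg.Zm k)⁻¹ (quarkEquiv (f, (Torus.proj (2 * S + 1) 0, a, i))) (quarkEquiv (f, (Torus.proj (2 * S + 1) (Pi.single 0 (n : ℤ)), b, j)))‖ ^ (2 : ℕ) : ℝ) : ℂ) ∂(wilsonMeasure (fundamentalRep (Fin 3)) (reg.β k))) / (∫ U : GaugeConfig 4 (2 * S + 1) (Matrix.specialUnitaryGroup (Fin 3) ℂ), (diracMatrix U fun _ : Fin Nf => reg.mcrit k + reg.a k * m /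 reg.Zm k).det ∂(wilsonMeasure (fundamentalRep (Fin 3)) (reg.β k)))‖) → reg.IsChiralAtZero := by
  intro Nf f g hfg hW reg hpin ε hε
  obtain ⟨m₀, hm₀, hpinC⟩ := hpin ε hε
  refine ⟨fun _ => m₀, fun _ => hm₀, fun hgap => ?_⟩
  obtain ⟨C, hC⟩ := hgap 1 1 (pseudoscalarDensityObs Nf (Matrix.single g f (1 : ℂ)))
    (pseudoscalarDensityObs Nf (Matrix.single f g (1 : ℂ)))
  obtain ⟨k, ⟨S, hS, n, hn, hlt⟩, hk⟩ := ((hpinC C).and_eventually hC).exists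
  have hle : ‖qcdLatticeConnectedCorr (reg.β k) (2 * S + 1)
      (fun _ : Fin Nf => reg.mcrit k + reg.a k * m₀ / reg.Zm k)
      (pseudoscalarDensityObs Nf (Matrix.single g f (1 : ℂ)))
      (pseudoscalarDensityObs Nf (Matrix.single f g (1 : ℂ))) n‖ ≤
      C * Real.exp (-(ε * (reg.a k * n))) := hk S hS n hn
  exact lt_irrefl _ (hlt.trans_le
    ((norm_signedQuotient_le_norm_corr hfg hW (reg.β k) (reg.mcrit k + reg.a k * m₀ / reg.Zm k)
      (2 * S + 1) n).trans hle))

end Summit.QuantumFields.QCD.Cruxes.ChiralOneScaleTrajectory.GoldstoneWitness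

end
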